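import Summits.CriticalPhenomena.SAWScalingLimit.Theorems.SAWRenewalTightnessTubeLowerBoundProfilePotentialDefs
import Literature.Probability.Percolation.LatticeSymmetry

/-!
# Crux `TubeLowerBound` (stmt-CriticalPhenomena-4730), line `profile-potential`: the reverse cut

`cornerExitEast_reverseCut : ∀ R n, 2 Σ_{k ≤ n} e_k q_{n−k} ≤ q_n`, where
`e_k = #cornerExitEast R k` counts the east first-exit prefixes of the closed square `[0,R]²` of a
corner-started self-avoiding walk of the quadrant `Q = {x ≥ 0, y ≥ 0}` of `ℤ²` and
`q_m = #quadWalks 0 m` the corner walks (objects of `…TubeLowerBoundProfilePotentialDefs`).  It is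
the combinatorial half of the registered by-product `cornerExitEast_mass_le_half`
(`Σ_{n ≤ N} e_n x_c^n ≤ 1/2`, file `…TubeLowerBoundReverseCut.lean`, which sums it at `x_c`), and the
converse direction of the first-exit cut `stub_quadrantCut` (`…TubeLowerBoundQuadrantCut.lean`).
PROVED outright (no named facts, no hypotheses).

Proof.  Glue an east first-exit prefix `π ∈ cornerExitEast R k` to the translate of ANY corner
walk `υ ∈ quadWalks 0 (n−k)` (`Zd.concatWalk k π υ`): before time `k` the prefix has `x ≤ R`, the
translated remainder has `x ≥ R + 1`, so the glued walk is self-avoiding (`Zd.concatWalk_mem_saws`,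
`glue_mem_saws`) and stays in the quadrant (`glue_mem_quadWalks`); its diagonal mirror image
(`transposeIso`) is a second corner walk (`transpose_mem_quadWalks`).  The triple `(k, π, υ)` is
recovered from the glued walk — `k` is its first exit time from `[0,R]²` (`exit_unique`), then the
prefix and the translated remainder are read off (`prefix_glue`, `suffix_glue`;
`glue_injective`) — and an east-glued walk is never a mirror image of one (at the exit time
`x = R + 1` versus `x ≤ R`, `glue_ne_mirror`): two injections with disjoint images, counted by
`Finset.card_image_of_injOn` and `Finset.card_union_of_disjoint`.  No new definitions.

Sources: J. M. Hammersley, D. J. A. Welsh, Quart. J. Math. Oxford (2) 13 (1962) 108–110 (cutting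
and gluing walks at a first passage); N. Madras, G. Slade, *The Self-Avoiding Walk* (Birkhäuser
1993), §1.2 (concatenation of walks, (1.2.3), (1.2.15)); B. Simon, Comm. Math. Phys. 77 (1980)
111–126 and E. H. Lieb, ibid. 127–135 (the cut inequality whose converse this is).
-/

noncomputable section

namespace Summit.CriticalPhenomena.SAWScalingLimit.Theorems.TubeLowerBound.ProfilePotential

open scoped BigOperators Classical
open Literature.Probability.LatticeModels
open Literature.Probability.RandomPlanarGeometry Literature.Probability.RandomPlanarGeometry.SAW
open Literature.Probability.Percolation (transposeIso transposeIso_apply_zero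
  transposeIso_apply_one)

namespace ReverseCutProof

/-- The glued walk `concatWalk k π υ` of an east first-exit prefix `π ∈ cornerExitEast R k` and the
translate of a corner walk `υ ∈ quadWalks 0 (n−k)` is an `n`-step self-avoiding walk: before time
`k` the prefix has `x ≤ R`, the translated remainder has `x ≥ R + 1`, and `υ` leaves its start. -/
theorem glue_mem_saws {R n k : ℕ} {π υ : ℕ → Site 2} (hkn : k ≤ n) (hπ : π ∈ cornerExitEast R k)
    (hυ : υ ∈ quadWalks 0 (n - k)) : Zd.concatWalk k π υ ∈ Zd.saws 2 n := by
  rw [cornerExitEast, Finset.mem_filter] at hπ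
  obtain ⟨hπs, hbefore, hat⟩ := hπ
  rw [quadWalks, Finset.mem_filter] at hυ
  obtain ⟨hυs, hquad⟩ := hυ
  have h := Zd.concatWalk_mem_saws hπs hυs fun i hi j hj1 hj2 heq => ?_
  · rwa [Nat.add_sub_cancel' hkn] at h
  · have hq := hquad j hj2
    simp only [Nat.cast_zero, neg_zero] at hq
    rcases hi.lt_or_eq with hi | hik
    · have hb := hbefore i hi
      have h0 := congrFun heq 0
      simp only [Pi.add_apply] at h0
      omega
    · rw [hik] at heq
      obtain ⟨hυ0, -, -, hinj⟩ := Zd.mem_saws.1 hυs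
      have hj0 : υ j = 0 := by simpa using heq.symm
      have : j = 0 := hinj (by simp only [Set.mem_setOf_eq]; omega)
        (by simp only [Set.mem_setOf_eq]; omega) (hj0.trans hυ0.symm)
      omega

/-- The glued walk is a corner walk of the quadrant: the prefix lies in `[0,R]²` (and at `(R+1,y)`,
`y ≥ 0`, at time `k`), the remainder is a quadrant walk translated by `π k ≥ 0`. -/
theorem glue_mem_quadWalks {R n k : ℕ} {π υ : ℕ → Site 2} (hkn : k ≤ n)
    (hπ : π ∈ cornerExitEast R k) (hυ : υ ∈ quadWalks 0 (n - k)) :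
    Zd.concatWalk k π υ ∈ quadWalks 0 n := by
  have hsaw := glue_mem_saws hkn hπ hυ
  rw [cornerExitEast, Finset.mem_filter] at hπ
  obtain ⟨-, hbefore, hat⟩ := hπ
  rw [quadWalks, Finset.mem_filter] at hυ
  obtain ⟨-, hquad⟩ := hυ
  rw [quadWalks, Finset.mem_filter]
  refine ⟨hsaw, fun i hi => ?_⟩
  simp only [Nat.cast_zero, neg_zero]
  by_cases hik : i ≤ k
  · simp only [Zd.concatWalk, if_pos hik]
    rcases hik.lt_or_eq with h | h
    · have := hbefore i h
      omega
    · rw [h]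
      omega
  · simp only [Zd.concatWalk, if_neg hik, Pi.add_apply]
    have hq := hquad (i - k) (by omega)
    simp only [Nat.cast_zero, neg_zero] at hq
    omega

/-- Up to time `k` the glued walk is the prefix. -/
theorem glue_apply_of_le {k i : ℕ} {π υ : ℕ → Site 2} (hi : i ≤ k) :
    Zd.concatWalk k π υ i = π i := by
  simp only [Zd.concatWalk, if_pos hi]

/-- The glued walk cut at time `k`: its frozen prefix is `π`. -/
theorem prefix_glue {k : ℕ} {π υ : ℕ → Site 2} (hπs : π ∈ Zd.saws 2 k) :
    (fun i => Zd.concatWalk k π υ (min i k)) = π := by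
  funext i
  rcases le_or_gt i k with hi | hi
  · simp only [min_eq_left hi, Zd.concatWalk, if_pos hi]
  · simp only [min_eq_right hi.le, Zd.concatWalk, if_pos le_rfl]
    exact ((Zd.mem_saws.1 hπs).2.1 i hi.le).symm

/-- The glued walk cut at time `k`: its translated, frozen remainder is `υ`. -/
theorem suffix_glue {n k : ℕ} {π υ : ℕ → Site 2} (hυs : υ ∈ Zd.saws 2 (n - k)) :
    (fun j => Zd.concatWalk k π υ (k + min j (n - k)) - Zd.concatWalk k π υ k) = υ := by
  obtain ⟨hυ0, hυend, -, -⟩ := Zd.mem_saws.1 hυs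
  funext j
  show (if k + min j (n - k) ≤ k then π (k + min j (n - k)) else π k + υ (k + min j (n - k) - k)) -
      (if k ≤ k then π k else π k + υ (k - k)) = υ j
  rw [if_pos le_rfl]
  by_cases h : k + min j (n - k) ≤ k
  · rw [if_pos h]
    have hmin : min j (n - k) = 0 := by omega
    rw [hmin, add_zero, sub_self]
    rcases Nat.eq_zero_or_pos j with hj | hj
    · rw [hj, hυ0]
    · rw [hυend j (by omega), show n - k = 0 by omega, hυ0]
  · rw [if_neg h, Nat.add_sub_cancel_left, add_sub_cancel_left]
    rcases le_or_gt j (n - k) with hj | hj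
    · rw [min_eq_left hj]
    · rw [min_eq_right hj.le, hυend j hj.le]

/-- **First-exit uniqueness.** A time before which the walk is in `[0,R]²` and at which it is
not is unique. -/
theorem exit_unique {R k k' : ℕ} {ω : ℕ → Site 2}
    (hk : ∀ i < k, 0 ≤ ω i 0 ∧ ω i 0 ≤ (R : ℤ) ∧ 0 ≤ ω i 1 ∧ ω i 1 ≤ (R : ℤ))
    (hk' : ¬(0 ≤ ω k 0 ∧ ω k 0 ≤ (R : ℤ) ∧ 0 ≤ ω k 1 ∧ ω k 1 ≤ (R : ℤ)))
    (hl : ∀ i < k', 0 ≤ ω i 0 ∧ ω i 0 ≤ (R : ℤ) ∧ 0 ≤ ω i 1 ∧ ω i 1 ≤ (R : ℤ))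
    (hl' : ¬(0 ≤ ω k' 0 ∧ ω k' 0 ≤ (R : ℤ) ∧ 0 ≤ ω k' 1 ∧ ω k' 1 ≤ (R : ℤ))) : k = k' := by
  rcases lt_trichotomy k k' with h | h | h
  · exact absurd (hl k h) hk'
  · exact h
  · exact absurd (hk k' h) hl'

/-- The diagonal mirror image of a corner walk of the quadrant is a corner walk of the quadrant. -/
theorem transpose_mem_quadWalks {n : ℕ} {ω : ℕ → Site 2} (hω : ω ∈ quadWalks 0 n) :
    (fun i => transposeIso (ω i)) ∈ quadWalks 0 n := by
  -- adapted from `QuadrantCutProof.transpose_prefix_mem_cornerExitEast`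
  rw [quadWalks, Finset.mem_filter] at hω ⊢
  obtain ⟨hsaw, hquad⟩ := hω
  obtain ⟨h0, hend, hadj, hinj⟩ := Zd.mem_saws.1 hsaw
  refine ⟨Zd.mem_saws.2 ⟨?_, fun i hi => ?_, fun i hi => transposeIso.map_adj_iff.2 (hadj i hi),
    fun i hi j hj hij => hinj hi hj (transposeIso.injective hij)⟩, fun i hi => ?_⟩
  · show transposeIso (ω 0) = 0
    rw [h0]
    funext i
    fin_cases i <;> simp
  · show transposeIso (ω i) = transposeIso (ω n)
    rw [hend i hi]
  · have h := hquad i hi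
    simp only [transposeIso_apply_zero, transposeIso_apply_one, Nat.cast_zero, neg_zero] at h ⊢
    exact ⟨h.2, h.1⟩

/-- The east-glued walk of an east first-exit prefix is in `[0,R]²` before time `k` and at
`(R+1, y)` with `0 ≤ y ≤ R` at time `k`. -/
theorem glue_exit {R k : ℕ} {π υ : ℕ → Site 2} (hπ : π ∈ cornerExitEast R k) :
    (∀ i < k, 0 ≤ Zd.concatWalk k π υ i 0 ∧ Zd.concatWalk k π υ i 0 ≤ (R : ℤ) ∧
        0 ≤ Zd.concatWalk k π υ i 1 ∧ Zd.concatWalk k π υ i 1 ≤ (R : ℤ)) ∧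
      Zd.concatWalk k π υ k 0 = (R : ℤ) + 1 ∧ 0 ≤ Zd.concatWalk k π υ k 1 ∧
        Zd.concatWalk k π υ k 1 ≤ (R : ℤ) := by
  rw [cornerExitEast, Finset.mem_filter] at hπ
  refine ⟨fun i hi => ?_, ?_⟩
  · rw [glue_apply_of_le hi.le]
    exact hπ.2.1 i hi
  · rw [glue_apply_of_le le_rfl]
    exact hπ.2.2

/-- **The gluing is injective**: the cut time is the first exit time of the glued walk from
`[0,R]²`, then the prefix and the translated remainder are read off. -/
theorem glue_injective {R n k k' : ℕ} {π υ π' υ' : ℕ → Site 2} (hπ : π ∈ cornerExitEast R k)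
    (hυ : υ ∈ quadWalks 0 (n - k)) (hπ' : π' ∈ cornerExitEast R k')
    (hυ' : υ' ∈ quadWalks 0 (n - k')) (h : Zd.concatWalk k π υ = Zd.concatWalk k' π' υ') :
    k = k' ∧ π = π' ∧ υ = υ' := by
  obtain ⟨hb, hat⟩ := glue_exit (υ := υ) hπ
  obtain ⟨hb', hat'⟩ := glue_exit (υ := υ') hπ'
  have hkk : k = k' := by
    refine exit_unique (R := R) hb ?_ ?_ ?_
    · omega
    · rw [h]
      exact hb'
    · rw [h]
      omega
  subst hkk
  have hπs : π ∈ Zd.saws 2 k := (Finset.mem_filter.1 hπ).1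
  have hπs' : π' ∈ Zd.saws 2 k := (Finset.mem_filter.1 hπ').1
  have hυs : υ ∈ Zd.saws 2 (n - k) := (Finset.mem_filter.1 hυ).1
  have hυs' : υ' ∈ Zd.saws 2 (n - k) := (Finset.mem_filter.1 hυ').1
  exact ⟨rfl, (prefix_glue (υ := υ) hπs).symm.trans
      ((congrArg (fun ω i => ω (min i k)) h).trans (prefix_glue hπs')),
    (suffix_glue (π := π) hυs).symm.trans
      ((congrArg (fun ω j => ω (k + min j (n - k)) - ω k) h).trans (suffix_glue hυs'))⟩

/-- **An east-glued walk is never the mirror image of one**: at the (common) first exit time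
from `[0,R]²` the former has `x = R + 1`, the latter `x ≤ R`. -/
theorem glue_ne_mirror {R k k' : ℕ} {π υ π' υ' : ℕ → Site 2} (hπ : π ∈ cornerExitEast R k)
    (hπ' : π' ∈ cornerExitEast R k')
    (h : (fun i => transposeIso (Zd.concatWalk k' π' υ' i)) = Zd.concatWalk k π υ) : False := by
  obtain ⟨hb, hat⟩ := glue_exit (υ := υ) hπ
  obtain ⟨hb', hat'⟩ := glue_exit (υ := υ') hπ'
  have hkk : k = k' := by
    refine exit_unique (R := R) hb ?_ ?_ ?_
    · omega
    · intro i hi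
      rw [← h]
      have := hb' i hi
      simp only [transposeIso_apply_zero, transposeIso_apply_one]
      exact ⟨this.2.2.1, this.2.2.2, this.1, this.2.1⟩
    · rw [← h]
      simp only [transposeIso_apply_zero, transposeIso_apply_one]
      omega
  subst hkk
  have h1 := congrArg (fun p : Site 2 => p 0) (congrFun h k)
  simp only [transposeIso_apply_zero] at h1
  omega

/-- Membership in the pieces `Σ_{k ≤ n} cornerExitEast R k × quadWalks 0 (n − k)`, unpacked. -/
theorem mem_pieces {R n k : ℕ} {π υ : ℕ → Site 2}
    (hs : (⟨k, π, υ⟩ : Σ _ : ℕ, (ℕ → Site 2) × (ℕ → Site 2)) ∈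
      (Finset.range (n + 1)).sigma fun k => cornerExitEast R k ×ˢ quadWalks 0 (n - k)) :
    k ≤ n ∧ π ∈ cornerExitEast R k ∧ υ ∈ quadWalks 0 (n - k) := by
  simp only [Finset.mem_sigma, Finset.mem_range, Finset.mem_product] at hs
  exact ⟨Nat.le_of_lt_succ hs.1, hs.2.1, hs.2.2⟩

end ReverseCutProof

open ReverseCutProof in
/-- **The reverse cut** (registered sub-goal `cornerExitEast_reverseCut` of stmt-CriticalPhenomena-4730,
line `profile-potential`): for all `R n`, `2 Σ_{k ≤ n} e_k q_{n−k} ≤ q_n` with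
`e_k = #cornerExitEast R k`, `q_m = #quadWalks 0 m` — gluing an east first-exit prefix of `[0,R]²`,
or its diagonal mirror image, to the translate of any corner walk of the quadrant gives two
injections `Σ_{k ≤ n} cornerExitEast R k × quadWalks 0 (n−k) → quadWalks 0 n` with disjoint images
(the converse direction of the Simon–Lieb / Hammersley–Welsh first-exit cut `stub_quadrantCut`).
(Hammersley–Welsh 1962; Madras–Slade 1993, §1.2.) -/
theorem cornerExitEast_reverseCut : ∀ R n : ℕ,
    2 * ∑ k ∈ Finset.range (n + 1), (cornerExitEast R k).card * (quadWalks 0 (n - k)).card ≤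
      (quadWalks 0 n).card := by
  intro R n
  -- the pieces and the two gluings (east; north = mirror image of east)
  set P : Finset (Σ _ : ℕ, (ℕ → Site 2) × (ℕ → Site 2)) :=
    (Finset.range (n + 1)).sigma fun k => cornerExitEast R k ×ˢ quadWalks 0 (n - k) with hP
  set gE : (Σ _ : ℕ, (ℕ → Site 2) × (ℕ → Site 2)) → ℕ → Site 2 :=
    fun s => Zd.concatWalk s.1 s.2.1 s.2.2 with hgE
  set gN : (Σ _ : ℕ, (ℕ → Site 2) × (ℕ → Site 2)) → ℕ → Site 2 :=
    fun s i => transposeIso (Zd.concatWalk s.1 s.2.1 s.2.2 i) with hgN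
  have hcard : P.card =
      ∑ k ∈ Finset.range (n + 1), (cornerExitEast R k).card * (quadWalks 0 (n - k)).card := by
    rw [hP, Finset.card_sigma]
    exact Finset.sum_congr rfl fun k _ => Finset.card_product _ _
  have hEinj : Set.InjOn gE ↑P := by
    rintro ⟨k, π, υ⟩ hs ⟨k', π', υ'⟩ hs' h
    obtain ⟨-, hπ, hυ⟩ := mem_pieces hs
    obtain ⟨-, hπ', hυ'⟩ := mem_pieces hs'
    obtain ⟨rfl, rfl, rfl⟩ := glue_injective hπ hυ hπ' hυ' h
    rfl
  have hNinj : Set.InjOn gN ↑P := fun s hs s' hs' h =>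
    hEinj hs hs' (funext fun i => transposeIso.injective (congrFun h i))
  have hdisj : Disjoint (P.image gE) (P.image gN) := by
    rw [Finset.disjoint_left]
    intro ω hE hN
    rw [Finset.mem_image] at hE hN
    obtain ⟨⟨k, π, υ⟩, hs, rfl⟩ := hE
    obtain ⟨⟨k', π', υ'⟩, hs', h⟩ := hN
    exact glue_ne_mirror (mem_pieces hs).2.1 (mem_pieces hs').2.1 h
  rw [← hcard, two_mul]
  calc P.card + P.card = (P.image gE).card + (P.image gN).card := by
        rw [Finset.card_image_of_injOn hEinj, Finset.card_image_of_injOn hNinj]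
    _ = (P.image gE ∪ P.image gN).card := (Finset.card_union_of_disjoint hdisj).symm
    _ ≤ (quadWalks 0 n).card := by
        refine Finset.card_le_card (Finset.union_subset ?_ ?_) <;>
          refine Finset.image_subset_iff.2 ?_ <;> rintro ⟨k, π, υ⟩ hs <;>
          obtain ⟨hkn, hπ, hυ⟩ := mem_pieces hs
        · exact glue_mem_quadWalks hkn hπ hυ
        · exact transpose_mem_quadWalks (glue_mem_quadWalks hkn hπ hυ)

end Summit.CriticalPhenomena.SAWScalingLimit.Theorems.TubeLowerBound.ProfilePotential

end
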